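import Summits.QuantumFields.BalabanUV.Beta.GAN24.WrecAtSlotOfShapes
import Summits.QuantumFields.BalabanUV.Beta.GAN24.StencilSlotLamDriftRoot
import Summits.QuantumFields.BalabanUV.Beta.GAN24.StencilSlotCauchyOfShapes

/-!
# `BalabanUV.Beta.GAN24.WrecAtSlotRows` — binder row G-an2-4 ∕ (CONV-C), **CT-W SOCKET, PART 2**: THE «S′Shape» ∧ «S′Drift» ROWS OF THE UNFOLDED
# FIRST-ORDER TABLES `SpureRecAt` FROM THE S-SLOT ROWS (hS, hSall) OF THE COMB FAMILY `SrecAt` (the Λ piece peeled off by road S3's rooted Λ rows),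
# AND THE W-SLOT ROWS (hW, hWall) OF `WrecAt` ⟸ (hS, hSall) OF `SrecAt` ∧ «T2Shape» ∧ «T2Drift» OF `T2RecAt` (`d = 3`, `Lc ≥ 2`, every in-block root)

NOT IN PRINT; OUR BOOKKEEPING (road-P2 chair of row G-an2-4, unit `b2b-balaban-gan24-p2` gen 35, crux team (2); journal `CLAIMS.log` INTENT «CT-W SCOPING»
[GAN24P2-G35-INTENT1]; PART 1 = `GAN24/WrecAtSlotOfShapes`).  HONEST FRAMING (cell contract, verbatim): «discharging `BetaPertH` makes Bałaban's UV stability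
UNCONDITIONAL — a real constructive-QFT result; it is NOT the continuum limit and NOT the Clay problem.»  HONEST DEPENDENCY (verbatim): «continuum YM on T⁴ ⇐
BetaPertH ∧ nine spine estimates (0/9 proved); BetaPertH ⇐ (D1) ∧ (D4) ∧ CAP+tail; G-an2-4 gates asym, D1 and NE2/3/4.»

WHAT.  `SrecAt (j+1) = SpureRecAt (j+1) + (cΛ·wΛ (j+1)) • SLam Lc (lamCoeffK (KInvStep Lc (j+1)) (E2 (j+1)) Lc) hessFFAt(ρ)` (`SpineRecursiveW.SrecAt_eq_SpureRecAt_add_lam_succ`,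
`rfl`-level), so in the adopted units the S-slot argument of `WrecAt` differs from the comb family `SrecAt` — whose rows (hS, hSall) at the pin `cE = Lc^4` are the
OWNER's `SrecAtSlotRows.exists_hS_hSall_SrecAt_three_of_born` (CT-4e; ⟸ the born sectors' rate half) — by the ROOTED LAGRANGE SUMMAND of road S3, whose uniform row
(`StencilSlotLamRoot.locStencil_unitS_lamPiece`, leaf-03 g40) and drift row (`StencilSlotLamDriftRoot.locStencil_unitS_lamPiece_sub`) are TREE THEOREMS as functions of
the UNDRESSED K-slot (`UnitDecayK` ∕ `CauchyDecayK` = road P1's `KSlotAssembly.convCKWall_holds` at `d = 3`).  Member `0` is one fixed local table (`locStencil_SpureRecAt … 0`).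
## Contents
§1 `SpureRecAt_succ_eq_sub` ∕ `unitS_SpureRecAt_succ_eq` (the peel, by `rfl` + `unitS_sub`); §2 (generic `d`, in-block root, K-slot as letters) **`exists_hS_SpureRecAt_of_rows`**
(«S′Shape» ⟸ hS ∧ `UnitDecayK`), **`exists_hSall_SpureRecAt_of_rows`** («S′Drift» ⟸ hS ∧ hSall ∧ `UnitDecayK` ∧ `CauchyDecayK`; ratio `max (max θK θS) ½`, the member-`0`
pairs by the uniform row); §3 (`d = 3`, `2 ≤ Lc`) **`exists_spureRecAt_rows_three_of_srecAt_rows`** (K-slot discharged); §4 **`hW_hWall_WrecAt_three_of_srecAt_rows`** —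
THE W-SLOT ROWS OF `WrecAt 3 Lc (toSite r) cE cVH cΛ cE₂ cB T vh₂S (mixFFAt (toSite r) Lc)` ⟸ (hS, hSall) OF `SrecAt 3 Lc (toSite r) cE cVH cΛ` ∧ «T2Shape» ∧ «T2Drift» OF
`T2RecAt …` (PART 1's `hW_hWall_WrecAt_three_of_rows` ∘ §3); §5 **`hW_hWall_WrecAt_three_of_srecAt_allRoots`** — the same fed by the OWNER gan24-p1 g22's all-roots END shape
(`SrecAtSlotRows.exists_hS_hSall_SrecAt_three_of_born`, verbatim as a hypothesis): with CT-4e's S-rows in the tree, **CT-W for the literal of record = EXACTLY the two T₂ rows of `T2RecAt`**.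
[folklore] compositions BY NAME; 0 `def`, 0 cited facts, 0 `def … : Prop`, 0 sorry; NO estimate of Bałaban's; discharges NOTHING of (hW, hWall) or (hS, hSall): SOCKETS whose
letters are OPEN.  NEVER «G-an2-4 closed» as (CONV-C); NOT D1, NOT `BetaPertH`, NOT continuum, NOT Clay; not in print — our bookkeeping.
Unit `b2b-balaban-gan24-p2` (gen 35), 2026-08-21.
-/

noncomputable section

open Finset
open scoped BigOperators
open Literature.MathematicalPhysics.QuantumFieldTheory
open Literature.MathematicalPhysics.QuantumFieldTheory.Balaban1983to89
open Literature.MathematicalPhysics.QuantumFieldTheory.Balaban1983to89.Beta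
open B12Sec2to5 (l1 l1_nonneg)
open ExpKernelCalculus (MKer Decays BiLoc VertexFamily VertexFamily₂ Zl)
open OneStepResolventKernel (Fib LocStencil decays_mono)
open OneStepKernelFamily (KInvStep)
open AffineAveraging (box toSite)
open InterLevelTransport (SLam)
open AveragingHessianKernels (ell)
open AveragingHessianKernelsRooted (hessFFAt)
open AveragingMixedJetTables (mixFFAt)
open BalabanStepJetsSucc (wΛ E2 lamCoeffK)
open BalabanCompositeJets (LocStencil₂)
open Summit.QuantumFields.BalabanUV.Beta.HessKerDressedUnits (unitS unitW unitS_sub)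
open Summit.QuantumFields.BalabanUV.Beta.SecondOrderUnits (unitS₂)
open Summit.QuantumFields.BalabanUV.Beta.SpineRooted (SpureRecAt T2RecAt WrecAt locStencil_SpureRecAt SrecAt_eq_SpureRecAt_add_lam_succ)
open Summit.QuantumFields.BalabanUV.Beta.WardLocusRecursive (SrecAt)
open Summit.QuantumFields.BalabanUV.Beta.GAN24.CombesThomas (sfStep smStep UnitDecayK CauchyDecayK)
open Summit.QuantumFields.BalabanUV.Beta.GAN24.KSlotAssembly (convCKWall_holds)
open Summit.QuantumFields.BalabanUV.Beta.GAN24.StencilSlotOfShapes (locStencil_mono' unitS_step_zero)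
open Summit.QuantumFields.BalabanUV.Beta.GAN24.StencilSlotCauchyOfShapes (locStencil_sub)
open Summit.QuantumFields.BalabanUV.Beta.GAN24.StencilSlotLamRoot (locStencil_unitS_lamPiece)
open Summit.QuantumFields.BalabanUV.Beta.GAN24.StencilSlotLamDriftRoot (locStencil_unitS_lamPiece_sub)
open Summit.QuantumFields.BalabanUV.Beta.GAN24.WrecAtSlotOfShapes (hW_hWall_WrecAt_three_of_rows)

namespace Summit.QuantumFields.BalabanUV.Beta.GAN24.WrecAtSlotRows

variable {d : ℕ} {Lc : ℕ} [NeZero Lc]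

/-! ## §1 The peel: the unfolded tables are the comb tables minus the rooted Lagrange summand -/

/-- [folklore] `SpureRecAt (j+1) = SrecAt (j+1) − Λ_{j+1}` as table families (`SrecAt_eq_SpureRecAt_add_lam_succ`, rearranged). -/
theorem SpureRecAt_succ_eq_sub (ρ : Fin (d + 1) → ℤ) (cE cVH cΛ : ℝ) (j : ℕ) :
    SpureRecAt d Lc ρ cE cVH cΛ (j + 1) = SrecAt d Lc ρ cE cVH cΛ (j + 1) -
      fun κ' u' => (cΛ * wΛ d Lc (j + 1)) •
        SLam Lc (lamCoeffK (KInvStep (d := d) Lc (j + 1)) (E2 d Lc (j + 1)) Lc) (fun μ y => hessFFAt ρ Lc μ y) κ' u' := by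
  funext κ' u'
  rw [Pi.sub_apply, Pi.sub_apply, SrecAt_eq_SpureRecAt_add_lam_succ ρ cE cVH cΛ j κ' u', add_sub_cancel_right]

/-- [folklore] THE PEEL IN UNITS: `unitS sf sm (SpureRecAt (j+1)) = unitS sf sm (SrecAt (j+1)) − unitS sf sm Λ_{j+1}` (`unitS_sub`). -/
theorem unitS_SpureRecAt_succ_eq (sf sm : ℝ) (ρ : Fin (d + 1) → ℤ) (cE cVH cΛ : ℝ) (j : ℕ) :
    unitS sf sm (SpureRecAt d Lc ρ cE cVH cΛ (j + 1)) = unitS sf sm (SrecAt d Lc ρ cE cVH cΛ (j + 1)) -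
      unitS sf sm (fun κ' u' => (cΛ * wΛ d Lc (j + 1)) •
        SLam Lc (lamCoeffK (KInvStep (d := d) Lc (j + 1)) (E2 d Lc (j + 1)) Lc) (fun μ y => hessFFAt ρ Lc μ y) κ' u') := by
  rw [SpureRecAt_succ_eq_sub, unitS_sub]

/-! ## §2 «S′Shape» and «S′Drift» from the comb family's rows and the undressed K-slot -/

section Generic

variable {r : Fin (d + 1) → ℕ}

/-- NOT IN PRINT; OUR BOOKKEEPING — A SOCKET (generic `d`, in-block root; [folklore] assembly).  **«S′Shape»: THE UNIFORM UNIT ROW OF `SpureRecAt (toSite r)` FROM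
THE COMB FAMILY's UNIFORM ROW `hS` AND THE K-SLOT's DECAY HALF** — members `≥ 1` by the peel (§1) and road S3's rooted Λ row
`StencilSlotLamRoot.locStencil_unitS_lamPiece`; member `0` is one fixed local table (`locStencil_SpureRecAt … 0`, unit `1`).  One constant, one rate. -/
theorem exists_hS_SpureRecAt_of_rows (hLc : 1 ≤ Lc) (hr : r ∈ box (d + 1) Lc) {C δ : ℝ} (hK : UnitDecayK d Lc (sfStep Lc) (smStep d Lc) C δ)
    (hδ : 0 < δ) (cE cVH cΛ : ℝ) {Cs δS : ℝ}
    (hS : ∀ j, LocStencil (unitS (sfStep Lc j) (smStep d Lc j) (SrecAt d Lc (toSite r) cE cVH cΛ j)) Cs δS) (hδS : 0 < δS) :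
    ∃ Cs' δs' : ℝ, 0 < δs' ∧ ∀ j, LocStencil (unitS (sfStep Lc j) (smStep d Lc j) (SpureRecAt d Lc (toSite r) cE cVH cΛ j)) Cs' δs' := by
  obtain ⟨C₀, δ₀, hδ₀, h0⟩ := locStencil_SpureRecAt (d := d) (Lc := Lc) hLc hr cE cVH cΛ 0
  have hC₀ : 0 ≤ C₀ := (h0 0 0).nonneg (Sum.inl 0)
  have hCs : 0 ≤ Cs := ((hS 0) 0 0).nonneg (Sum.inl 0)
  -- road S3's rooted Λ row, members `≥ 1`
  have hΛ := fun j => locStencil_unitS_lamPiece (d := d) (Lc := Lc) hLc hr hK hδ cΛ j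
  set CΛ : ℝ := |cΛ * (Lc : ℝ) ^ (2 * (d + 1))| *
    ((d + 1 : ℕ) * (((Fintype.card (Fib d) : ℝ) * (C * C) * Zl (d + 1) (δ - δ / 2)) *
      (2 * (ell (d + 1) Lc : ℝ) ^ 2 * Real.exp (4 * ((d : ℝ) + 1) * Lc * (δ / 2))) * Zl (d + 1) (δ / 2 / 2))) with hCΛ_def
  have hCΛ : 0 ≤ CΛ := ((hΛ 0) 0 0).nonneg (Sum.inl 0)
  set m : ℝ := min δ₀ (min δS (δ / 2 / 2)) with hm_def
  have hm0 : 0 < m := lt_min hδ₀ (lt_min hδS (by positivity))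
  have hm₀ : m ≤ δ₀ := min_le_left _ _
  have hmS : m ≤ δS := (min_le_right _ _).trans (min_le_left _ _)
  have hmΛ : m ≤ δ / 2 / 2 := (min_le_right _ _).trans (min_le_right _ _)
  refine ⟨max C₀ (Cs + CΛ), m, hm0, fun j => ?_⟩
  cases j with
  | zero =>
      rw [unitS_step_zero]
      exact locStencil_mono' h0 (le_max_left _ _) hm₀
  | succ j =>
      rw [unitS_SpureRecAt_succ_eq]
      exact locStencil_mono' (locStencil_sub (locStencil_mono' (hS (j + 1)) le_rfl hmS) (locStencil_mono' (hΛ j) le_rfl hmΛ))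
        (le_max_right _ _) le_rfl

/-- NOT IN PRINT; OUR BOOKKEEPING — A SOCKET (generic `d`, in-block root; [folklore] assembly).  **«S′Drift»: THE ALL-SCALES CAUCHY UNIT ROW OF
`SpureRecAt (toSite r)` FROM THE COMB FAMILY's ROWS (hS, hSall) AND THE K-SLOT** — pairs `(k+1+j, k+1)` by the peel (§1), `sub_sub_sub_comm`, the comb family's
Cauchy row and road S3's rooted Λ drift row `StencilSlotLamDriftRoot.locStencil_unitS_lamPiece_sub` (ratio `θK`, members `≥ 1`); the pairs `(j, 0)` by the
uniform row twice.  ONE ratio `θ′ = max (max θK θS) ½ < 1` (the `½` absorbs the index shift of the Λ row: `θK^k ≤ 2·θ′^{k+1}`), one constant, one rate. -/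
theorem exists_hSall_SpureRecAt_of_rows (hLc : 1 ≤ Lc) (hr : r ∈ box (d + 1) Lc) {C cK θK δ : ℝ}
    (hK : UnitDecayK d Lc (sfStep Lc) (smStep d Lc) C δ) (hKall : CauchyDecayK d Lc (sfStep Lc) (smStep d Lc) cK θK δ) (hδ : 0 < δ)
    (hθK0 : 0 ≤ θK) (hθK1 : θK < 1) (cE cVH cΛ : ℝ) {Cs cS θS δS : ℝ}
    (hS : ∀ j, LocStencil (unitS (sfStep Lc j) (smStep d Lc j) (SrecAt d Lc (toSite r) cE cVH cΛ j)) Cs δS)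
    (hSall : ∀ k j, LocStencil (unitS (sfStep Lc (k + j)) (smStep d Lc (k + j)) (SrecAt d Lc (toSite r) cE cVH cΛ (k + j)) -
      unitS (sfStep Lc k) (smStep d Lc k) (SrecAt d Lc (toSite r) cE cVH cΛ k)) (cS * θS ^ k) δS)
    (hδS : 0 < δS) (hθS0 : 0 ≤ θS) (hθS1 : θS < 1) :
    ∃ Cs' cS' θ' δ' : ℝ, 0 ≤ θ' ∧ θ' < 1 ∧ 0 < δ' ∧
      (∀ j, LocStencil (unitS (sfStep Lc j) (smStep d Lc j) (SpureRecAt d Lc (toSite r) cE cVH cΛ j)) Cs' δ') ∧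
      (∀ k j, LocStencil (unitS (sfStep Lc (k + j)) (smStep d Lc (k + j)) (SpureRecAt d Lc (toSite r) cE cVH cΛ (k + j)) -
        unitS (sfStep Lc k) (smStep d Lc k) (SpureRecAt d Lc (toSite r) cE cVH cΛ k)) (cS' * θ' ^ k) δ') := by
  obtain ⟨Cs', δ₁, hδ₁, hS'⟩ := exists_hS_SpureRecAt_of_rows hLc hr hK hδ cE cVH cΛ hS hδS
  have hCs' : 0 ≤ Cs' := ((hS' 0) 0 0).nonneg (Sum.inl 0)
  have hcS : 0 ≤ cS := by have h := ((hSall 0 0) 0 0).nonneg (Sum.inl 0); simpa using h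
  -- road S3's rooted Λ drift row, members `≥ 1`
  have hΛd := fun k j => locStencil_unitS_lamPiece_sub (d := d) (Lc := Lc) hLc hr hK hKall hδ hθK0 cΛ k j
  set CΛd : ℝ := |cΛ * (Lc : ℝ) ^ (2 * (d + 1))| *
    ((d + 1 : ℕ) * (((Fintype.card (Fib d) : ℝ) * (cK * θK * C + C * cK) * Zl (d + 1) (δ - δ / 2)) *
      (2 * (ell (d + 1) Lc : ℝ) ^ 2 * Real.exp (4 * ((d : ℝ) + 1) * Lc * (δ / 2))) * Zl (d + 1) (δ / 2 / 2))) with hCΛd_def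
  have hCΛd : 0 ≤ CΛd := by have h := ((hΛd 0 0) 0 0).nonneg (Sum.inl 0); simpa using h
  -- the common ratio and the common rate
  set θ' : ℝ := max (max θK θS) (1 / 2) with hθ'_def
  have hθ'0 : 0 ≤ θ' := hθK0.trans ((le_max_left _ _).trans (le_max_left _ _))
  have hθ'1 : θ' < 1 := max_lt (max_lt hθK1 hθS1) (by norm_num)
  have hKθ : θK ≤ θ' := (le_max_left _ _).trans (le_max_left _ _)
  have hSθ : θS ≤ θ' := (le_max_right _ _).trans (le_max_left _ _)
  have hhalf : (1 / 2 : ℝ) ≤ θ' := le_max_right _ _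
  set m : ℝ := min δ₁ (min δS (δ / 2 / 2)) with hm_def
  have hm0 : 0 < m := lt_min hδ₁ (lt_min hδS (by positivity))
  have hm₁ : m ≤ δ₁ := min_le_left _ _
  have hmS : m ≤ δS := (min_le_right _ _).trans (min_le_left _ _)
  have hmΛ : m ≤ δ / 2 / 2 := (min_le_right _ _).trans (min_le_right _ _)
  refine ⟨Cs', max (Cs' + Cs') (cS + 2 * CΛd), θ', m, hθ'0, hθ'1, hm0, fun j => locStencil_mono' (hS' j) le_rfl hm₁, fun k j => ?_⟩
  cases k with
  | zero =>
      -- the pairs `(j, 0)`: two uniform rows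
      have h := locStencil_sub (locStencil_mono' (hS' (0 + j)) le_rfl hm₁) (locStencil_mono' (hS' 0) le_rfl hm₁)
      refine locStencil_mono' h ?_ le_rfl
      rw [pow_zero, mul_one]
      exact le_max_left _ _
  | succ k =>
      -- the pairs `(k+1+j, k+1)`: peel both members, regroup, comb Cauchy row + Λ drift row
      have e : k + 1 + j = k + j + 1 := by omega
      rw [e, unitS_SpureRecAt_succ_eq, unitS_SpureRecAt_succ_eq, sub_sub_sub_comm]
      have hSS : LocStencil (unitS (sfStep Lc (k + j + 1)) (smStep d Lc (k + j + 1)) (SrecAt d Lc (toSite r) cE cVH cΛ (k + j + 1)) -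
          unitS (sfStep Lc (k + 1)) (smStep d Lc (k + 1)) (SrecAt d Lc (toSite r) cE cVH cΛ (k + 1))) (cS * θ' ^ (k + 1)) m := by
        have h := hSall (k + 1) j
        rw [e] at h
        exact locStencil_mono' h (mul_le_mul_of_nonneg_left (pow_le_pow_left₀ hθS0 hSθ (k + 1)) hcS) hmS
      have hΛΛ : LocStencil
          (unitS (sfStep Lc (k + j + 1)) (smStep d Lc (k + j + 1))
              (fun κ' u' => (cΛ * wΛ d Lc (k + j + 1)) •
                SLam Lc (lamCoeffK (KInvStep (d := d) Lc (k + j + 1)) (E2 d Lc (k + j + 1)) Lc) (fun μ y => hessFFAt (toSite r) Lc μ y) κ' u') -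
            unitS (sfStep Lc (k + 1)) (smStep d Lc (k + 1))
              (fun κ' u' => (cΛ * wΛ d Lc (k + 1)) •
                SLam Lc (lamCoeffK (KInvStep (d := d) Lc (k + 1)) (E2 d Lc (k + 1)) Lc) (fun μ y => hessFFAt (toSite r) Lc μ y) κ' u'))
          ((2 * CΛd) * θ' ^ (k + 1)) m := by
        have hθk : θK ^ k ≤ θ' ^ k := pow_le_pow_left₀ hθK0 hKθ k
        have hbound : CΛd * θK ^ k ≤ (2 * CΛd) * θ' ^ (k + 1) := by
          have h1 : CΛd * θK ^ k ≤ CΛd * θ' ^ k := mul_le_mul_of_nonneg_left hθk hCΛd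
          have h2 : CΛd * θ' ^ k ≤ (2 * CΛd) * θ' ^ (k + 1) := by
            rw [pow_succ]
            nlinarith [mul_nonneg hCΛd (pow_nonneg hθ'0 k)]
          exact h1.trans h2
        exact locStencil_mono' (hΛd k j) hbound hmΛ
      refine locStencil_mono' (locStencil_sub hSS hΛΛ) ?_ le_rfl
      calc cS * θ' ^ (k + 1) + 2 * CΛd * θ' ^ (k + 1) = (cS + 2 * CΛd) * θ' ^ (k + 1) := by ring
        _ ≤ max (Cs' + Cs') (cS + 2 * CΛd) * θ' ^ (k + 1) :=
            mul_le_mul_of_nonneg_right (le_max_right _ _) (pow_nonneg hθ'0 _)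

end Generic

/-! ## §3 `d = 3`, `Lc ≥ 2`: the K-slot discharged -/

section Three

variable {Lc : ℕ} [NeZero Lc] {r : Fin (3 + 1) → ℕ}

/-- NOT IN PRINT; OUR BOOKKEEPING — A SOCKET (`d = 3`, `2 ≤ Lc`, in-block root; every `cE cVH cΛ`).  **«S′Shape» ∧ «S′Drift» OF `SpureRecAt 3 Lc (toSite r)` FROM THE
COMB FAMILY's (hS, hSall) ALONE** — road P1's K-pair `KSlotAssembly.convCKWall_holds` (TREE, hypothesis-free) supplies `UnitDecayK` ∕ `CauchyDecayK`. -/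
theorem exists_spureRecAt_rows_three_of_srecAt_rows (hLc : 2 ≤ Lc) (hr : r ∈ box (3 + 1) Lc) (cE cVH cΛ : ℝ) {Cs cS θS δS : ℝ}
    (hS : ∀ j, LocStencil (unitS (sfStep Lc j) (smStep 3 Lc j) (SrecAt 3 Lc (toSite r) cE cVH cΛ j)) Cs δS)
    (hSall : ∀ k j, LocStencil (unitS (sfStep Lc (k + j)) (smStep 3 Lc (k + j)) (SrecAt 3 Lc (toSite r) cE cVH cΛ (k + j)) -
      unitS (sfStep Lc k) (smStep 3 Lc k) (SrecAt 3 Lc (toSite r) cE cVH cΛ k)) (cS * θS ^ k) δS)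
    (hδS : 0 < δS) (hθS0 : 0 ≤ θS) (hθS1 : θS < 1) :
    ∃ Cs' cS' θ' δ' : ℝ, 0 ≤ θ' ∧ θ' < 1 ∧ 0 < δ' ∧
      (∀ j, LocStencil (unitS (sfStep Lc j) (smStep 3 Lc j) (SpureRecAt 3 Lc (toSite r) cE cVH cΛ j)) Cs' δ') ∧
      (∀ k j, LocStencil (unitS (sfStep Lc (k + j)) (smStep 3 Lc (k + j)) (SpureRecAt 3 Lc (toSite r) cE cVH cΛ (k + j)) -
        unitS (sfStep Lc k) (smStep 3 Lc k) (SpureRecAt 3 Lc (toSite r) cE cVH cΛ k)) (cS' * θ' ^ k) δ') := by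
  have hLc1 : 1 ≤ Lc := by omega
  obtain ⟨C, δK, cK, θK, hδK, hθK0, hθK1, hK, hKall⟩ := convCKWall_holds (Lc := Lc) hLc
  exact exists_hSall_SpureRecAt_of_rows hLc1 hr hK hKall hδK hθK0 hθK1 cE cVH cΛ hS hSall hδS hθS0 hθS1

/-! ## §4 The W-slot rows of the comb family wait on its S-slot rows and the two T₂ rows only -/

/-- NOT IN PRINT; OUR PROOF ATTEMPT — A SOCKET (`d = 3`, `2 ≤ Lc`, in-block root `r`, an1's rooted mixed table; every `cE cVH cΛ cE₂ cB`, every `T`, every `vh₂S`).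
**THE W-SLOT ROWS (hW, hWall) OF an2's RECURSIVE WALL FAMILY `WrecAt` FROM THE S-SLOT ROWS (hS, hSall) OF THE COMB FAMILY `SrecAt` AND «T2Shape» ∧ «T2Drift» OF
`T2RecAt` ALONE** (PART 1's `WrecAtSlotOfShapes.hW_hWall_WrecAt_three_of_rows` ∘ §3).  With the OWNER's `SrecAtSlotRows.exists_hS_hSall_SrecAt_three_of_born` at the
pin `cE = Lc^4` (⟸ the born sectors' rate half), the W-slot rows the D1 literal of record `D1BFx.RoadEndRowPinned.exists_allScalesSeq_JsRowD1Pin_of_slots` consumes wait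
on EXACTLY the two T₂ rows of `T2RecAt 3 Lc ρ_c (Lc^4) (−Lc^8∕2) (2∕Lc^4) (Lc^8) (−Lc^12∕4) ((8N²)⁻¹•wsym22 N) (vh₂SAn1 Lc) (mixFFAt ρ_c Lc)` = CT-W.  Discharges NOTHING of
(hW, hWall); NEVER «G-an2-4 closed» as (CONV-C). -/
theorem hW_hWall_WrecAt_three_of_srecAt_rows (hLc : 2 ≤ Lc) (hr : r ∈ box (3 + 1) Lc) (cE cVH cΛ cE₂ cB : ℝ)
    (T : Fin 4 → Fin 4 → Fin 4 → Fin 4 → ℝ) (vh₂S : Fin (3 + 1) → (Fin (3 + 1) → ℤ) → Fin (3 + 1) → (Fin (3 + 1) → ℤ) → MKer (3 + 1) (Fib 3))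
    {Cs cS θS δS : ℝ}
    (hS : ∀ j, LocStencil (unitS (sfStep Lc j) (smStep 3 Lc j) (SrecAt 3 Lc (toSite r) cE cVH cΛ j)) Cs δS)
    (hSall : ∀ k j, LocStencil (unitS (sfStep Lc (k + j)) (smStep 3 Lc (k + j)) (SrecAt 3 Lc (toSite r) cE cVH cΛ (k + j)) -
      unitS (sfStep Lc k) (smStep 3 Lc k) (SrecAt 3 Lc (toSite r) cE cVH cΛ k)) (cS * θS ^ k) δS)
    (hδS : 0 < δS) (hθS0 : 0 ≤ θS) (hθS1 : θS < 1)
    {C₂ c₂ θ₂ δ₂ : ℝ}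
    (hT₂ : ∀ j, LocStencil₂ (unitS₂ (sfStep Lc j) (smStep 3 Lc j)
      (T2RecAt 3 Lc (toSite r) cE cVH cΛ cE₂ cB T vh₂S (mixFFAt (toSite r) Lc) j)) C₂ δ₂)
    (hT₂d : ∀ k j, LocStencil₂ (unitS₂ (sfStep Lc (k + j)) (smStep 3 Lc (k + j))
        (T2RecAt 3 Lc (toSite r) cE cVH cΛ cE₂ cB T vh₂S (mixFFAt (toSite r) Lc) (k + j)) -
      unitS₂ (sfStep Lc k) (smStep 3 Lc k) (T2RecAt 3 Lc (toSite r) cE cVH cΛ cE₂ cB T vh₂S (mixFFAt (toSite r) Lc) k)) (c₂ * θ₂ ^ k) δ₂)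
    (hδ₂ : 0 < δ₂) (hθ₂0 : 0 ≤ θ₂) (hθ₂1 : θ₂ < 1) :
    ∃ Cw cW θW δW : ℝ, 0 ≤ θW ∧ θW < 1 ∧ 0 < δW ∧
      (∀ j, VertexFamily₂ (unitW (sfStep Lc j) (smStep 3 Lc j)
        (WrecAt 3 Lc (toSite r) cE cVH cΛ cE₂ cB T vh₂S (mixFFAt (toSite r) Lc) j)) Lc Cw δW) ∧
      (∀ k j, VertexFamily₂ (unitW (sfStep Lc (k + j)) (smStep 3 Lc (k + j))
          (WrecAt 3 Lc (toSite r) cE cVH cΛ cE₂ cB T vh₂S (mixFFAt (toSite r) Lc) (k + j)) -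
        unitW (sfStep Lc k) (smStep 3 Lc k) (WrecAt 3 Lc (toSite r) cE cVH cΛ cE₂ cB T vh₂S (mixFFAt (toSite r) Lc) k)) Lc (cW * θW ^ k) δW) := by
  obtain ⟨Cs', cS', θ', δ', hθ'0, hθ'1, hδ', hS', hSall'⟩ :=
    exists_spureRecAt_rows_three_of_srecAt_rows hLc hr cE cVH cΛ hS hSall hδS hθS0 hθS1
  exact hW_hWall_WrecAt_three_of_rows hLc hr cE cVH cΛ cE₂ cB T vh₂S hS' hSall' hδ' hθ'0 hθ'1 hT₂ hT₂d hδ₂ hθ₂0 hθ₂1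

/-! ## §5 The same, fed by the OWNER's all-roots S-slot END shape -/

/-- NOT IN PRINT; OUR PROOF ATTEMPT — A SOCKET (`d = 3`, `2 ≤ Lc`; every `cE cVH cΛ cE₂ cB T vh₂S`; the root `r` of the W rows fixed, the S rows for ALL roots).
**THE W-SLOT ROWS OF `WrecAt` AT THE ROOT `r` FROM THE OWNER's ALL-ROOTS S-SLOT END SHAPE** — the hypothesis `hrows` is CHARACTER FOR CHARACTER the conclusion of
gan24-p1 g22's `SrecAtSlotRows.exists_hS_hSall_SrecAt_three_of_born (hLc) (hcE) (cVH cΛ) (hB)` (staged 2026-08-21; any `cE` here), so that, once it lands,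
`hW_hWall_WrecAt_three_of_srecAt_allRoots hLc hr … (exists_hS_hSall_SrecAt_three_of_born hLc hcE cVH cΛ hB) hT₂ hT₂d …` is ONE term.  Discharges NOTHING. -/
theorem hW_hWall_WrecAt_three_of_srecAt_allRoots (hLc : 2 ≤ Lc) (hr : r ∈ box (3 + 1) Lc) (cE cVH cΛ cE₂ cB : ℝ)
    (T : Fin 4 → Fin 4 → Fin 4 → Fin 4 → ℝ) (vh₂S : Fin (3 + 1) → (Fin (3 + 1) → ℤ) → Fin (3 + 1) → (Fin (3 + 1) → ℤ) → MKer (3 + 1) (Fib 3))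
    (hrows : ∃ Cs cS θS δS : ℝ, 0 ≤ θS ∧ θS < 1 ∧ 0 < δS ∧ ∀ (rr : Fin (3 + 1) → ℕ), rr ∈ box (3 + 1) Lc →
      (∀ j : ℕ, LocStencil (unitS (sfStep Lc j) (smStep 3 Lc j) (SrecAt 3 Lc (toSite rr) cE cVH cΛ j)) Cs δS) ∧
      (∀ k j : ℕ, LocStencil (unitS (sfStep Lc (k + j)) (smStep 3 Lc (k + j)) (SrecAt 3 Lc (toSite rr) cE cVH cΛ (k + j))
        - unitS (sfStep Lc k) (smStep 3 Lc k) (SrecAt 3 Lc (toSite rr) cE cVH cΛ k)) (cS * θS ^ k) δS))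
    {C₂ c₂ θ₂ δ₂ : ℝ}
    (hT₂ : ∀ j, LocStencil₂ (unitS₂ (sfStep Lc j) (smStep 3 Lc j)
      (T2RecAt 3 Lc (toSite r) cE cVH cΛ cE₂ cB T vh₂S (mixFFAt (toSite r) Lc) j)) C₂ δ₂)
    (hT₂d : ∀ k j, LocStencil₂ (unitS₂ (sfStep Lc (k + j)) (smStep 3 Lc (k + j))
        (T2RecAt 3 Lc (toSite r) cE cVH cΛ cE₂ cB T vh₂S (mixFFAt (toSite r) Lc) (k + j)) -
      unitS₂ (sfStep Lc k) (smStep 3 Lc k) (T2RecAt 3 Lc (toSite r) cE cVH cΛ cE₂ cB T vh₂S (mixFFAt (toSite r) Lc) k)) (c₂ * θ₂ ^ k) δ₂)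
    (hδ₂ : 0 < δ₂) (hθ₂0 : 0 ≤ θ₂) (hθ₂1 : θ₂ < 1) :
    ∃ Cw cW θW δW : ℝ, 0 ≤ θW ∧ θW < 1 ∧ 0 < δW ∧
      (∀ j, VertexFamily₂ (unitW (sfStep Lc j) (smStep 3 Lc j)
        (WrecAt 3 Lc (toSite r) cE cVH cΛ cE₂ cB T vh₂S (mixFFAt (toSite r) Lc) j)) Lc Cw δW) ∧
      (∀ k j, VertexFamily₂ (unitW (sfStep Lc (k + j)) (smStep 3 Lc (k + j))
          (WrecAt 3 Lc (toSite r) cE cVH cΛ cE₂ cB T vh₂S (mixFFAt (toSite r) Lc) (k + j)) -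
        unitW (sfStep Lc k) (smStep 3 Lc k) (WrecAt 3 Lc (toSite r) cE cVH cΛ cE₂ cB T vh₂S (mixFFAt (toSite r) Lc) k)) Lc (cW * θW ^ k) δW) := by
  obtain ⟨Cs, cS, θS, δS, hθS0, hθS1, hδS, hall⟩ := hrows
  obtain ⟨hS, hSall⟩ := hall r hr
  exact hW_hWall_WrecAt_three_of_srecAt_rows hLc hr cE cVH cΛ cE₂ cB T vh₂S hS hSall hδS hθS0 hθS1 hT₂ hT₂d hδ₂ hθ₂0 hθ₂1

end Three

end Summit.QuantumFields.BalabanUV.Beta.GAN24.WrecAtSlotRows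

end
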